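import Literature.AlgebraicGeometry.ModuliOfAbelianVarieties.SiegelCMSpecialPairPeriodIso
import HarnessLib

/-!
# The period isomorphism of a CM special pair, normalised at ANY cyclic vector
# ([Deligne 1971] 4.18; [Milne 2005] Ex. 12.4 (b); [Shimura 1998] §6.1–6.2)

Topic `AlgebraicGeometry/ModuliOfAbelianVarieties`; namespace `Literature.AlgebraicGeometry.ModuliOfAbelianVarieties.CMStructure`.
Cell hodgecm-mathlib (D-0151), #60 road / Mumford line (row I-7 `SiegelS1`; lead A-p05; M3a sub-table, census A-p06): a banked GENERIC
leaf, THEOREMS ONLY (no definition, no named fact, no instance, no `sorry`; net Literature debt 0).  Sequel of ★ R60-33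
`SiegelCMSpecialPairPeriodIso` (B-p11).  HC_CM is proved only modulo the printed citations until rung 0 closes.

## What is proved

★ R60-33 `IsSpecial.exists_periodIso` gives, at a special pair `(c, J, Φ)`, an `ℝ`-linear chart `e : ℝ^{2g} ≃ ∏ᵢ ℂ^{Φᵢ}` with
(a) `e(J v) = √−1·e(v)`, (b) `e(act(x) v) = u(x)·e(v)`, and (c) `e(act(x)·v₀) = u(x)` for SOME cyclic vector `v₀`.  The Mumford line's
junction (α∀) (B-p09 `RouteXi.CMAdaptedMarkingsAll`) and sandwich (β) are quantified over EVERY cyclic vector; this file re-normalises: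

* `apply_ne_zero_of_equivariant_of_bijective` — for a chart with (b) and ANY cyclic `v₀` (`x ↦ act(x)·v₀` bijective), every coordinate of
  `e(v₀)` is non-zero (else the coordinate functional kills `e(ℚ^{2g})`, whose `ℝ`-span is everything).
* **`exists_periodIso_at_of_equivariant`** — from (a), (b) and any cyclic `v₀`: a chart `e′ = e(v₀)⁻¹·e` with (a), (b) and (c) AT `v₀`.
* **`IsSpecial.exists_periodIso_at`** — HEAD: at a special pair, for EVERY cyclic `v₀` there is a chart with (a), (b), (c) at `v₀`.

## References
* [Deligne1971TravauxShimura] P. Deligne, *Travaux de Shimura*, Sém. Bourbaki 389 (1971), 4.18 p. 150.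
* [Milne2005ShimuraVarieties] J. S. Milne, *Introduction to Shimura varieties* (2005), Ex. 12.4 (b) p. 112.
* [Shimura1998] G. Shimura, *Abelian Varieties with Complex Multiplication and Modular Functions* (1998), §6.1–6.2 pp. 40–45.
-/

set_option autoImplicit false

noncomputable section

open Module Function NumberField Matrix

namespace Literature.AlgebraicGeometry.ModuliOfAbelianVarieties

namespace CMStructure

open Literature.AlgebraicGeometry.Motives (CMType)
open Literature.NumberTheory.ComplexMultiplication (CMTypeLattice.cmEmbedding)

variable {g : ℕ} {δ : Fin g → ℕ} {ι : Type} [Fintype ι] [DecidableEq ι] {K : ι → Type} [∀ i, Field (K i)]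
  [∀ i, NumberField (K i)] [∀ i, IsCMField (K i)] (c : CMStructure g δ ι K) (Φ : ∀ i, CMType (K i))

/-! ### §1. A chart equivariant for `F` does not vanish at a cyclic vector -/

omit [DecidableEq ι] in
/-- The real vector of `act(x)·v` is `actMatrix(x)_ℝ · v̂`. [cite: Deligne1971TravauxShimura, 4.18 p. 150] -/
private theorem ratCast_act_eq_mulVec (x : Π i, K i) (v : Fin g ⊕ Fin g → ℚ) :
    ((algebraMap ℚ ℝ) ∘ (c.act x v) : Fin g ⊕ Fin g → ℝ) = (c.actMatrix x).map (algebraMap ℚ ℝ) *ᵥ ((algebraMap ℚ ℝ) ∘ v) := by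
  rw [actMatrix_def]
  funext j
  change algebraMap ℚ ℝ (c.act x v j) = _
  rw [← RingHom.map_mulVec, LinearMap.toMatrix'_mulVec]

omit [DecidableEq ι] in
/-- **Every coordinate of `e(v₀)` is non-zero** when `e` is an `F`-EQUIVARIANT linear isomorphism (`e(act(x) v) = u(x)·e(v)`) and `v₀` is
cyclic (`x ↦ act(x)·v₀` bijective onto `ℚ^{2g}`): otherwise the coordinate `(i, φ)` of `e(act(x)·v₀) = u(x)·e(v₀)` vanishes for every `x`,
i.e. on `e(ℚ^{2g})`, whose `ℝ`-span is `∏ᵢ ℂ^{Φᵢ}` — absurd. [cite: Shimura1998, §6.1–6.2 pp. 40–45] [cite: Milne2005ShimuraVarieties, Ex. 12.4 (b) p. 112] -/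
theorem apply_ne_zero_of_equivariant_of_bijective (e : (Fin g ⊕ Fin g → ℝ) ≃ₗ[ℝ] (Π i, ((Φ i).1 → ℂ)))
    (hb : ∀ (x : Π i, K i) (v : Fin g ⊕ Fin g → ℝ),
      e ((c.actMatrix x).map (algebraMap ℚ ℝ) *ᵥ v) = (fun i => CMTypeLattice.cmEmbedding (Φ i) (x i)) * e v)
    {v₀ : Fin g ⊕ Fin g → ℚ} (hv₀ : Function.Bijective fun x : Π i, K i => c.act x v₀) (i : ι) (φ : (Φ i).1) :
    e ((algebraMap ℚ ℝ) ∘ v₀) i φ ≠ 0 := by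
  classical
  intro h0
  -- the coordinate `(i, φ)` vanishes on `e(ŵ)` for every rational `w`
  have hrat : ∀ w : Fin g ⊕ Fin g → ℚ, e ((algebraMap ℚ ℝ) ∘ w) i φ = 0 := by
    intro w
    obtain ⟨x, rfl⟩ := hv₀.2 w
    change e ((algebraMap ℚ ℝ) ∘ (c.act x v₀)) i φ = 0
    rw [c.ratCast_act_eq_mulVec, hb, Pi.mul_apply, Pi.mul_apply, h0, mul_zero]
  -- hence on every real vector (the standard basis vectors are rational)
  have hall : ∀ v : Fin g ⊕ Fin g → ℝ, e v i φ = 0 := by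
    intro v
    have hv : v = ∑ k, v k • ((algebraMap ℚ ℝ) ∘ (Pi.single k (1 : ℚ) : Fin g ⊕ Fin g → ℚ)) := by
      conv_lhs => rw [← (Pi.basisFun ℝ (Fin g ⊕ Fin g)).sum_repr v]
      refine Finset.sum_congr rfl fun k _ => ?_
      congr 1
      funext j
      rw [Pi.basisFun_apply, Function.comp_apply]
      by_cases hj : j = k
      · subst hj; rw [Pi.single_eq_same, Pi.single_eq_same, map_one]
      · rw [Pi.single_eq_of_ne hj, Pi.single_eq_of_ne hj, map_zero]
    rw [hv, map_sum, Finset.sum_apply, Finset.sum_apply]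
    refine Finset.sum_eq_zero fun k _ => ?_
    rw [map_smul, Pi.smul_apply, Pi.smul_apply, hrat, smul_zero]
  -- contradiction with surjectivity at the vector `ιᵢ(δ_φ)`
  obtain ⟨v, hv⟩ := e.surjective (Pi.single i (Pi.single φ 1))
  have h1 := hall v
  rw [hv, Pi.single_eq_same, Pi.single_eq_same] at h1
  exact one_ne_zero h1

/-! ### §2. Re-normalising at a cyclic vector: `e′ = e(v₀)⁻¹ · e` -/

omit [DecidableEq ι] in
/-- **Re-normalisation.**  From an `F`-equivariant chart `e` with `e ∘ J = √−1·e` and ANY cyclic vector `v₀`, the chart `e′(v) = e(v₀)⁻¹·e(v)`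
(coordinatewise; `e(v₀)` has non-zero coordinates by `apply_ne_zero_of_equivariant_of_bijective`) satisfies (a) `e′ ∘ J = √−1·e′`,
(b) `e′(act(x) v) = u(x)·e′(v)` and (c) `e′(act(x)·v₀) = u(x)` — the chart of ★ R60-33 normalised AT `v₀`.
[cite: Shimura1998, §6.2 Thm. 3–4, pp. 42–45] [cite: Milne2005ShimuraVarieties, Ex. 12.4 (b) p. 112] [cite: Deligne1971TravauxShimura, 4.18 p. 150] -/
theorem exists_periodIso_at_of_equivariant {J : Matrix (Fin g ⊕ Fin g) (Fin g ⊕ Fin g) ℝ}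
    (e : (Fin g ⊕ Fin g → ℝ) ≃ₗ[ℝ] (Π i, ((Φ i).1 → ℂ)))
    (ha : ∀ v, e (J *ᵥ v) = Complex.I • e v)
    (hb : ∀ (x : Π i, K i) (v : Fin g ⊕ Fin g → ℝ),
      e ((c.actMatrix x).map (algebraMap ℚ ℝ) *ᵥ v) = (fun i => CMTypeLattice.cmEmbedding (Φ i) (x i)) * e v)
    {v₀ : Fin g ⊕ Fin g → ℚ} (hv₀ : Function.Bijective fun x : Π i, K i => c.act x v₀) :
    ∃ e' : (Fin g ⊕ Fin g → ℝ) ≃ₗ[ℝ] (Π i, ((Φ i).1 → ℂ)),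
      (∀ v, e' (J *ᵥ v) = Complex.I • e' v) ∧
      (∀ (x : Π i, K i) (v : Fin g ⊕ Fin g → ℝ),
        e' ((c.actMatrix x).map (algebraMap ℚ ℝ) *ᵥ v) = (fun i => CMTypeLattice.cmEmbedding (Φ i) (x i)) * e' v) ∧
      ∀ x : Π i, K i, e' ((algebraMap ℚ ℝ) ∘ (c.act x v₀)) = fun i => CMTypeLattice.cmEmbedding (Φ i) (x i) := by
  -- the unit `w = e(v₀)` of the ring `∏ᵢ ℂ^{Φᵢ}` and multiplication by `w⁻¹` as an `ℝ`-linear automorphism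
  set w : Π i, ((Φ i).1 → ℂ) := e ((algebraMap ℚ ℝ) ∘ v₀) with hw
  have hwne : ∀ i φ, w i φ ≠ 0 := fun i φ => c.apply_ne_zero_of_equivariant_of_bijective Φ e hb hv₀ i φ
  set winv : Π i, ((Φ i).1 → ℂ) := fun i φ => (w i φ)⁻¹ with hwinv
  have hwinv_mul : winv * w = 1 := by
    funext i φ
    rw [Pi.mul_apply, Pi.mul_apply, hwinv, inv_mul_cancel₀ (hwne i φ), Pi.one_apply, Pi.one_apply]
  have hw_mul : w * winv = 1 := by rw [mul_comm, hwinv_mul]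
  let μ : (Π i, ((Φ i).1 → ℂ)) ≃ₗ[ℝ] (Π i, ((Φ i).1 → ℂ)) :=
    { toFun := fun z => winv * z
      map_add' := fun z z' => mul_add _ _ _
      map_smul' := fun r z => by
        rw [RingHom.id_apply]
        funext i φ
        simp only [Pi.mul_apply, Pi.smul_apply, Complex.real_smul]
        ring
      invFun := fun z => w * z
      left_inv := fun z => by change w * (winv * z) = z; rw [← mul_assoc, hw_mul, one_mul]
      right_inv := fun z => by change winv * (w * z) = z; rw [← mul_assoc, hwinv_mul, one_mul] }
  have hμ : ∀ z, μ z = winv * z := fun z => rfl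
  refine ⟨e.trans μ, fun v => ?_, fun x v => ?_, fun x => ?_⟩
  · rw [LinearEquiv.trans_apply, LinearEquiv.trans_apply, hμ, hμ, ha]
    funext i φ
    simp only [Pi.mul_apply, Pi.smul_apply, smul_eq_mul]
    ring
  · rw [LinearEquiv.trans_apply, LinearEquiv.trans_apply, hμ, hμ, hb, ← mul_assoc, ← mul_assoc, mul_comm winv]
  · rw [LinearEquiv.trans_apply, hμ, c.ratCast_act_eq_mulVec, hb, ← hw, mul_comm winv, mul_assoc, hw_mul, mul_one]

/-! ### §3. HEAD: the period isomorphism of a special pair at every cyclic vector -/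

/-- **THE PERIOD ISOMORPHISM OF A CM SPECIAL PAIR, NORMALISED AT ANY CYCLIC VECTOR.**  For a special pair `(c, J, Φ)` (★ `IsSpecial`) and
EVERY `v₀ ∈ ℚ^{2g}` with `x ↦ act(x)·v₀` bijective `F → ℚ^{2g}`, there is an `ℝ`-linear isomorphism `e : ℝ^{2g} ≃ ∏ᵢ ℂ^{Φᵢ}` with
(a) `e ∘ J = √−1·e`, (b) `e ∘ act(x) = u(x)·e`, (c) `e(act(x)·v₀) = u(x)` (★ R60-33 `IsSpecial.exists_periodIso` + §2). This is the shape the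
Mumford line's junctions quantify over (B-p09 `RouteXi.CMAdaptedMarkingsAll`, `CompletedSandwich`: «for every cyclic `v₀`»).
[cite: Deligne1971TravauxShimura, 4.18 p. 150] [cite: Milne2005ShimuraVarieties, Ex. 12.4 (b) p. 112] [cite: Shimura1998, §6.2 Thm. 3–4, pp. 42–45] -/
theorem IsSpecial.exists_periodIso_at {c : CMStructure g δ ι K} {J : C0pm δ} {Φ : ∀ i, CMType (K i)} (h : c.IsSpecial J Φ)
    {v₀ : Fin g ⊕ Fin g → ℚ} (hv₀ : Function.Bijective fun x : Π i, K i => c.act x v₀) :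
    ∃ e : (Fin g ⊕ Fin g → ℝ) ≃ₗ[ℝ] (Π i, ((Φ i).1 → ℂ)),
      (∀ v, e ((J : Matrix (Fin g ⊕ Fin g) (Fin g ⊕ Fin g) ℝ) *ᵥ v) = Complex.I • e v) ∧
      (∀ (x : Π i, K i) (v : Fin g ⊕ Fin g → ℝ),
        e ((c.actMatrix x).map (algebraMap ℚ ℝ) *ᵥ v) = (fun i => CMTypeLattice.cmEmbedding (Φ i) (x i)) * e v) ∧
      ∀ x : Π i, K i, e ((algebraMap ℚ ℝ) ∘ (c.act x v₀)) = fun i => CMTypeLattice.cmEmbedding (Φ i) (x i) := by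
  obtain ⟨e, ha, hb, -⟩ := h.exists_periodIso
  exact c.exists_periodIso_at_of_equivariant Φ e ha hb hv₀

end CMStructure

end Literature.AlgebraicGeometry.ModuliOfAbelianVarieties

end
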